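import Literature.NumberTheory.Automorphic.UnitaryDepthZeroPieceStrataLatticeTransportRamified   -- ★ p847358 (this seat): part 2 at the CM place (five counts, `¬ CLS c` form of the fifth); brings ★ p847257∕p847240 (part 1), ★ p847329∕p847316 (part 2 generic), ★ p847189, ★ p847117
import HarnessLib

/-!
# «A1′ COUNT TRANSPORT», part 2, ED. 2: the complementary rank-one stratum `n_¬□(t)` as the lattice count of the OTHER CLASS `1□_{εc}` (`ε` a residual non-square unit) —
# the (a2) sheet's two rank-one classes are literally `CLS c` and `CLS (ε·c)` (tame-ramified non-split CM place)

Topic `NumberTheory/Automorphic`; namespace `Literature.NumberTheory.Automorphic.UnitaryGroup`.  THEOREMS ONLY (no definition, no instance, no notation, no named fact, no `sorry`).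
Hand F0P3a-p05 (g16), 2026-09-02.  Cell `pub/hodgecm-mathlib`, crux H413 = `stmt-HodgeConjecture-24833`; road «S3-ram» (LEAD F0P3a-plan (g12); owner∕table F0P3a-p06 (g15)); architect
A-p16 (g31) ROAD-P1ram v2 row «A1′ COUNT TRANSPORT» (p05); companion of ★ p847358 (`UnitaryDepthZeroPieceStrataLatticeTransportRamified`), whose fifth count reads `… ∧ ¬ CLS c`.

THE MATHEMATICS ([Rogawski1990] §4.9 p. 55, §3.9 p. 32; [Kottwitz1986] §3).  §1 (any field): the class of the residual quadratic value through a residual frame `J̄ = c̄′ • ᵗĀ J₀ Ā` with an extra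
scalar `δ`: `(∃ z a ≠ 0, δ·zᵀ(J̄N)z = a²) ⟺ (∃ z a ≠ 0, (δc̄′)·zᵀ(J₀·ĀNĀ⁻¹)z = a²)` (★ p846957 `dotProduct_smul_formCongr_mul_mulVec`).  §2 (CM place, the frame `e g = A g_w A⁻¹` of ★ p846897):
the `δ`-TWISTED rank-one class count transports from `Fix_t(G′_v ⧸ K′)` to the model `U(σ_w, Φ₃)` exactly as the class `□` did in ★ p847257 (`δ = 1`): `#{… δ·zᵀ(J̄N(x))z = a²} =
#{… (δc̄′)·zᵀ(J₀N(u))z = a²}` (`c̄′ = red(−det H′_w)`).  §3: on a `v`-deep class the complementary rank-one stratum of ★ p847154 (`¬ ∃ z a ≠ 0, zᵀ(J̄N(x))z = a²`) IS the `ε̄⁻¹`-twisted class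
(`J̄N(x)` is symmetric of rank one, ★ p847189 `not_exists_depthOne_value_eq_sq_iff_exists_eq_sq_mul_ramified`: the values fill exactly one square class; `σ_w ϖ = −ϖ`, `H′` hermitian), so by
§2 and ★ p847329 (class constant `ε·c`, `red(εc)·ε̄⁻¹c̄′ = red c · c̄′ = 1`): **`n_¬□(t) = #{M : M self-dual, (e t)M = M, LEV ϖ ∧ ¬ LEV ϖ² ∧ LEV₂ ϖ³ ∧ CLS (ε·c)}`**.
HONEST LABEL: HC_CM is proved only modulo the 2 remaining named inputs (hLiu418 24832, h413 24833) until rung 0 closes; measure-free group bookkeeping, no books consequence.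

## References
* [Rogawski1990] J. D. Rogawski, *Automorphic Representations of Unitary Groups in Three Variables*, Ann. of Math. Stud. 123 (1990): §4.9 pp. 54–55; §3.9 p. 32; §14.2 p. 233.
* [Kottwitz1986] R. E. Kottwitz, *Base change for unit elements of Hecke algebras*, Compositio Math. 60 (1986): §3.
* [PlatonovRapinchuk1994] V. Platonov, A. Rapinchuk, *Algebraic Groups and Number Theory* (1994): §3.3, §5.1.
-/

set_option autoImplicit false

noncomputable section

open MeasureTheory Measure Set Filter Topology NumberField IsDedekindDomain Matrix ValuativeRel
open Literature.NumberTheory.Rogawski1990 Literature.NumberTheory.GaloisRepresentations Literature.NumberTheory.Automorphic.UnitaryGroup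
open Literature.NumberTheory.Automorphic.IntegralReduction Literature.GroupTheory.SpecificGroups Literature.NumberTheory.Automorphic.UnitaryLatticeTree
open Literature.NumberTheory.Automorphic.HermitianLattice
open scoped Matrix MatrixGroups ValuativeRel

namespace Literature.NumberTheory.Automorphic.UnitaryGroup

/-! ## §1 The twisted class through a residual frame (any field) -/

section Form

variable {K : Type*} [Field K]

/-- **THE `δ`-TWISTED CLASS UNDER THE FRAME**: for `J̄ = c • ᵗĀ J₀ Ā`, `(∃ z a, a ≠ 0 ∧ δ·zᵀ(J̄N)z = a²) ↔ (∃ z a, a ≠ 0 ∧ (δc)·zᵀ(J₀·ĀNĀ⁻¹)z = a²)` (★ p846957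
`dotProduct_smul_formCongr_mul_mulVec`, `z ↦ Āz`; `δ = 1` is ★ p847240 `exists_sq_value_iff_frameConj`). [cite: Rogawski1990, §3.9 p. 32] [cite: PlatonovRapinchuk1994, §3.3] -/
theorem exists_mul_value_eq_sq_iff_frameConj (Ab : GL (Fin 3) K) (c δ : K) (N : Matrix (Fin 3) (Fin 3) K) :
    (∃ (z : Fin 3 → K) (a : K), a ≠ 0 ∧ δ * (z ⬝ᵥ ((c • formCongr (RingHom.id K) Ab ((StdForm.antidiagonal 3).over K) * N) *ᵥ z)) = a ^ 2) ↔
      ∃ (z : Fin 3 → K) (a : K), a ≠ 0 ∧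
        (δ * c) * (z ⬝ᵥ ((((StdForm.antidiagonal 3).over K) * ((Ab : Matrix (Fin 3) (Fin 3) K) * N * ((Ab⁻¹ : GL (Fin 3) K) : Matrix (Fin 3) (Fin 3) K))) *ᵥ z)) = a ^ 2 := by
  constructor
  · rintro ⟨z, a, ha, hz⟩
    exact ⟨(Ab : Matrix (Fin 3) (Fin 3) K) *ᵥ z, a, ha, by rw [mul_assoc, ← dotProduct_smul_formCongr_mul_mulVec]; exact hz⟩
  · rintro ⟨z, a, ha, hz⟩
    refine ⟨((Ab⁻¹ : GL (Fin 3) K) : Matrix (Fin 3) (Fin 3) K) *ᵥ z, a, ha, ?_⟩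
    rw [dotProduct_smul_formCongr_mul_mulVec, Matrix.mulVec_mulVec, ← Units.val_mul, mul_inv_cancel, Units.val_one, Matrix.one_mulVec, ← mul_assoc]
    exact hz

end Form

/-! ## §2 The `δ`-twisted rank-one class count transports along the frame -/

section Transport

variable (L : Type) [Field L] [NumberField L] [IsCMField L] (H' : Matrix (Fin 3) (Fin 3) L) {v : HeightOneSpectrum (𝓞 ↥(maximalRealSubfield L))}
  (w : PlacesOver L v) (hw : IsCMField.complexConj L • w.1 = w.1) (he : v.asIdeal.ramificationIdx' w.1.asIdeal ≠ 1)
  (hH'w : IsUnit (placeForm H' w.1)) (hH'i : hH'w.unit ∈ glInt 3 (w.1.adicCompletion L))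
  (h2 : IsUnit (2 : 𝒪[(w.1.adicCompletion L)]))
  (ϖ : (w.1.adicCompletion L)) (hϖ : Valued.v ϖ = WithZero.exp (-1 : ℤ))
  (A : GL (Fin 3) (w.1.adicCompletion L)) (hA : A ∈ glInt 3 (w.1.adicCompletion L))
  (hframe : (placeForm H' w.1) = (-(placeForm H' w.1).det) • formCongr (galAdicCompletionMap (L := L) (IsCMField.complexConj L) hw) A ((StdForm.antidiagonal 3).over (w.1.adicCompletion L)))
  (e : ↥(UnitaryGroup.«local» L (IsCMField.complexConj L) 3 H' v) ≃ₜ* ↥(unitaryGroupOfForm (galAdicCompletionMap (L := L) (IsCMField.complexConj L) hw) (placeForm (Matrix.of fun i j : Fin 3 => if i.val + j.val + 1 = 3 then (1 : L) else 0) w.1)))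
  (heA : ∀ g : ((cmDatum L 3 H').Local v), (((e g) : ↥(unitaryGroupOfForm (galAdicCompletionMap (L := L) (IsCMField.complexConj L) hw) (placeForm (Matrix.of fun i j : Fin 3 => if i.val + j.val + 1 = 3 then (1 : L) else 0) w.1))) : GL (Fin 3) (w.1.adicCompletion L)) =
    A * ((localNonsplitEquiv (IsCMField.complexConj L) H' (IsCMField.complexConj_ne_one L) w hw g).val : GL (Fin 3) (w.1.adicCompletion L)) * A⁻¹)
  (hK : ∀ g : ((cmDatum L 3 H').Local v), g ∈ (cmLocalIntegralLevel L 3 H' v) ↔ (((e g) : ↥(unitaryGroupOfForm (galAdicCompletionMap (L := L) (IsCMField.complexConj L) hw) (placeForm (Matrix.of fun i j : Fin 3 => if i.val + j.val + 1 = 3 then (1 : L) else 0) w.1))) : GL (Fin 3) (w.1.adicCompletion L)) ∈ glInt 3 (w.1.adicCompletion L))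

include hw he hH'w hH'i hϖ hA hframe heA hK in
set_option maxHeartbeats 1600000 in
-- budget only: statement-heavy CM-place tokens (two coset currencies).
/-- **A1′ (the `δ`-twisted rank-one class)**: `#{q ∈ Fix_t : rank(red x_w − 1) = 0 ∧ rank N(x) = 1 ∧ ∃ z a ≠ 0, δ·zᵀ(J̄N(x))z = a²} = #{q′ ∈ Fix_(e t) : … ∧ ∃ z a ≠ 0, (δ·c̄′)·zᵀ(J₀N(u))z = a²}`
(`c̄′ = red(−det H′_w)`; `δ = 1` is ★ p847257 `ncard_fixedBy_interior_sq_eq_of_frame`). [cite: Rogawski1990, §14.2 p. 233; §3.9 p. 32] [cite: Kottwitz1986, §3] [cite: PlatonovRapinchuk1994, §3.3] -/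
theorem ncard_fixedBy_interior_classMul_eq_of_frame (t : ((cmDatum L 3 H').Local v)) (δ : 𝓀[(w.1.adicCompletion L)]) :
    {q : (((cmDatum L 3 H').Local v) ⧸ cmLocalIntegralLevel L 3 H' v) | q ∈ MulAction.fixedBy (((cmDatum L 3 H').Local v) ⧸ cmLocalIntegralLevel L 3 H' v) t ∧ ((redMat (((((q.out⁻¹ * t * q.out)).val : GL (Fin 3) (UnitaryGroup.LocalRing L v)).val.map (Pi.evalRingHom (fun w' : PlacesOver L v => w'.1.adicCompletion L) w))) - 1).rank = 0 ∧ (redMat (ϖ⁻¹ • (((((q.out⁻¹ * t * q.out)).val : GL (Fin 3) (UnitaryGroup.LocalRing L v)).val.map (Pi.evalRingHom (fun w' : PlacesOver L v => w'.1.adicCompletion L) w)) - 1))).rank = 1 ∧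
        ∃ (z : Fin 3 → 𝓀[(w.1.adicCompletion L)]) (a : 𝓀[(w.1.adicCompletion L)]), a ≠ 0 ∧ δ * (z ⬝ᵥ ((redMat (placeForm H' w.1) * redMat (ϖ⁻¹ • (((((q.out⁻¹ * t * q.out)).val : GL (Fin 3) (UnitaryGroup.LocalRing L v)).val.map (Pi.evalRingHom (fun w' : PlacesOver L v => w'.1.adicCompletion L) w)) - 1))) *ᵥ z)) = a ^ 2)}.ncard =
      {q : (↥(unitaryGroupOfForm (galAdicCompletionMap (L := L) (IsCMField.complexConj L) hw) (placeForm (Matrix.of fun i j : Fin 3 => if i.val + j.val + 1 = 3 then (1 : L) else 0) w.1)) ⧸ ((glInt 3 (w.1.adicCompletion L)).subgroupOf (unitaryGroupOfForm (galAdicCompletionMap (L := L) (IsCMField.complexConj L) hw) (placeForm (Matrix.of fun i j : Fin 3 => if i.val + j.val + 1 = 3 then (1 : L) else 0) w.1)))) | q ∈ MulAction.fixedBy (↥(unitaryGroupOfForm (galAdicCompletionMap (L := L) (IsCMField.complexConj L) hw) (placeForm (Matrix.of fun i j : Fin 3 => if i.val + j.val + 1 = 3 then (1 : L) else 0) w.1))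 ⧸ ((glInt 3 (w.1.adicCompletion L)).subgroupOf (unitaryGroupOfForm (galAdicCompletionMap (L := L) (IsCMField.complexConj L) hw) (placeForm (Matrix.of fun i j : Fin 3 => if i.val + j.val + 1 = 3 then (1 : L) else 0) w.1)))) (e t) ∧ ((redMat (((((q.out⁻¹ * e t * q.out) : ↥(unitaryGroupOfForm (galAdicCompletionMap (L := L) (IsCMField.complexConj L) hw) (placeForm (Matrix.of fun i j : Fin 3 => if i.val + j.val + 1 = 3 then (1 : L) else 0) w.1))) : GL (Fin 3) (w.1.adicCompletion L)) : Matrix (Fin 3) (Fin 3) (w.1.adicCompletion L))) - 1).rank = 0 ∧ (redMat (ϖ⁻¹ • (((((q.out⁻¹ * e t * q.out) : ↥(unitaryGroupOfForm (galAdicCompletionMap (L := L) (IsCMField.complexConj L) hw) (placeForm (Matrix.of fun i j : Fin 3 => if i.val + j.val + 1 = 3 then (1 : L) else 0) w.1))) : GL (Fin 3) (w.1.adicCompletion L)) : Matrix (Fin 3) (Fin 3) (w.1.adicCompletion L)) - 1))).rank = 1 ∧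
        ∃ (z : Fin 3 → 𝓀[(w.1.adicCompletion L)]) (a : 𝓀[(w.1.adicCompletion L)]), a ≠ 0 ∧ (δ * red (-((placeForm H' w.1)).det)) * (z ⬝ᵥ ((((StdForm.antidiagonal 3).over 𝓀[(w.1.adicCompletion L)]) * redMat (ϖ⁻¹ • (((((q.out⁻¹ * e t * q.out) : ↥(unitaryGroupOfForm (galAdicCompletionMap (L := L) (IsCMField.complexConj L) hw) (placeForm (Matrix.of fun i j : Fin 3 => if i.val + j.val + 1 = 3 then (1 : L) else 0) w.1))) : GL (Fin 3) (w.1.adicCompletion L)) : Matrix (Fin 3) (Fin 3) (w.1.adicCompletion L)) - 1))) *ᵥ z)) = a ^ 2)}.ncard := by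
  classical
  let Ab : GL (Fin 3) 𝓀[(w.1.adicCompletion L)] := ⟨redMat (A : Matrix (Fin 3) (Fin 3) (w.1.adicCompletion L)), redMat (((A⁻¹ : GL (Fin 3) (w.1.adicCompletion L))) : Matrix (Fin 3) (Fin 3) (w.1.adicCompletion L)),
    redMat_coe_mul_redMat_coe_inv hA, redMat_coe_inv_mul_redMat_coe hA⟩
  have hJb := redMat_placeForm_eq_smul_formCongr_redMat_of_frame L H' w hw he hH'w hH'i A hA hframe Ab rfl
  refine ncard_fixedBy_label_eq_of_frame L H' w hw e hK t
    (fun x => (redMat ((((x).val : GL (Fin 3) (UnitaryGroup.LocalRing L v)).val.map (Pi.evalRingHom (fun w' : PlacesOver L v => w'.1.adicCompletion L) w))) - 1).rank = 0 ∧ (redMat (ϖ⁻¹ • ((((x).val : GL (Fin 3) (UnitaryGroup.LocalRing L v)).val.map (Pi.evalRingHom (fun w' : PlacesOver L v => w'.1.adicCompletion L) w)) - 1))).rank = 1 ∧ ∃ (z : Fin 3 → 𝓀[(w.1.adicCompletion L)]) (a : 𝓀[(w.1.adicCompletion L)]), a ≠ 0 ∧ δ * (z ⬝ᵥ ((redMat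 (placeForm H' w.1) * redMat (ϖ⁻¹ • ((((x).val : GL (Fin 3) (UnitaryGroup.LocalRing L v)).val.map (Pi.evalRingHom (fun w' : PlacesOver L v => w'.1.adicCompletion L) w)) - 1))) *ᵥ z)) = a ^ 2)
    (fun u => (redMat ((((u : ↥(unitaryGroupOfForm (galAdicCompletionMap (L := L) (IsCMField.complexConj L) hw) (placeForm (Matrix.of fun i j : Fin 3 => if i.val + j.val + 1 = 3 then (1 : L) else 0) w.1))) : GL (Fin 3) (w.1.adicCompletion L)) : Matrix (Fin 3) (Fin 3) (w.1.adicCompletion L))) - 1).rank = 0 ∧ (redMat (ϖ⁻¹ • ((((u : ↥(unitaryGroupOfForm (galAdicCompletionMap (L := L) (IsCMField.complexConj L) hw) (placeForm (Matrix.of fun i j : Fin 3 => if i.val + j.val + 1 = 3 then (1 : L) else 0) w.1))) : GL (Fin 3) (w.1.adicCompletion L)) : Matrix (Fin 3) (Fin 3) (w.1.adicCompletion L)) - 1))).rank = 1 ∧ ∃ (z : Fin 3 → 𝓀[(w.1.adicCompletion L)]) (a : 𝓀[(w.1.adicCompletion L)]), a ≠ 0 ∧ (δ * red (-((placeForm H'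 w.1)).det)) * (z ⬝ᵥ ((((StdForm.antidiagonal 3).over 𝓀[(w.1.adicCompletion L)]) * redMat (ϖ⁻¹ • ((((u : ↥(unitaryGroupOfForm (galAdicCompletionMap (L := L) (IsCMField.complexConj L) hw) (placeForm (Matrix.of fun i j : Fin 3 => if i.val + j.val + 1 = 3 then (1 : L) else 0) w.1))) : GL (Fin 3) (w.1.adicCompletion L)) : Matrix (Fin 3) (Fin 3) (w.1.adicCompletion L)) - 1))) *ᵥ z)) = a ^ 2)
    (fun x hx => ?_) (fun k' hk' u hu => ?_)
  · obtain ⟨h1, h2⟩ := labels_frame_of_mem L H' w hw ϖ hϖ A hA e heA hx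
    have key : ∀ (hr0 : (redMat ((((x).val : GL (Fin 3) (UnitaryGroup.LocalRing L v)).val.map (Pi.evalRingHom (fun w' : PlacesOver L v => w'.1.adicCompletion L) w))) - 1).rank = 0),
        ((∃ (z : Fin 3 → 𝓀[(w.1.adicCompletion L)]) (a : 𝓀[(w.1.adicCompletion L)]), a ≠ 0 ∧ δ * (z ⬝ᵥ ((redMat (placeForm H' w.1) * redMat (ϖ⁻¹ • ((((x).val : GL (Fin 3) (UnitaryGroup.LocalRing L v)).val.map (Pi.evalRingHom (fun w' : PlacesOver L v => w'.1.adicCompletion L) w)) - 1))) *ᵥ z)) = a ^ 2) ↔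
          ∃ (z : Fin 3 → 𝓀[(w.1.adicCompletion L)]) (a : 𝓀[(w.1.adicCompletion L)]), a ≠ 0 ∧ (δ * red (-((placeForm H' w.1)).det)) * (z ⬝ᵥ ((((StdForm.antidiagonal 3).over 𝓀[(w.1.adicCompletion L)]) * redMat (ϖ⁻¹ • (((((e x) : ↥(unitaryGroupOfForm (galAdicCompletionMap (L := L) (IsCMField.complexConj L) hw) (placeForm (Matrix.of fun i j : Fin 3 => if i.val + j.val + 1 = 3 then (1 : L) else 0) w.1))) : GL (Fin 3) (w.1.adicCompletion L)) : Matrix (Fin 3) (Fin 3) (w.1.adicCompletion L)) - 1))) *ᵥ z)) = a ^ 2) := fun hr0 => by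
      rw [hJb, (h2 hr0).1]
      exact exists_mul_value_eq_sq_iff_frameConj Ab _ δ _
    constructor
    · rintro ⟨hr0, hr, hsq⟩; exact ⟨by rw [h1]; exact hr0, by rw [(h2 hr0).2]; exact hr, (key hr0).1 hsq⟩
    · rintro ⟨hr0, hr, hsq⟩
      have hr0' : (redMat ((((x).val : GL (Fin 3) (UnitaryGroup.LocalRing L v)).val.map (Pi.evalRingHom (fun w' : PlacesOver L v => w'.1.adicCompletion L) w))) - 1).rank = 0 := by rw [← h1]; exact hr0
      exact ⟨hr0', by rw [← (h2 hr0').2]; exact hr, (key hr0').2 hsq⟩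
  · obtain ⟨-, h0, h⟩ := labels_conj_of_mem_glInt L w hw he ϖ hϖ hk' hu
    constructor
    · rintro ⟨hr0, hr, hsq⟩
      have hr0' := h0.1 hr0
      exact ⟨hr0', by rw [← (h hr0').1]; exact hr, ((h hr0').2 _).1 hsq⟩
    · rintro ⟨hr0, hr, hsq⟩; exact ⟨h0.2 hr0, by rw [(h hr0).1]; exact hr, ((h hr0).2 _).2 hsq⟩

end Transport

/-! ## §3 The complementary rank-one stratum is the `ε`-class; its lattice count -/

section EpsilonClass

variable (L : Type) [Field L] [NumberField L] [IsCMField L] (H' : Matrix (Fin 3) (Fin 3) L) {v : HeightOneSpectrum (𝓞 ↥(maximalRealSubfield L))}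
  (w : PlacesOver L v) (hw : IsCMField.complexConj L • w.1 = w.1) (he : v.asIdeal.ramificationIdx' w.1.asIdeal ≠ 1)
  (hH'w : IsUnit (placeForm H' w.1)) (hH'i : hH'w.unit ∈ glInt 3 (w.1.adicCompletion L))
  (h2 : IsUnit (2 : 𝒪[(w.1.adicCompletion L)]))
  (ϖ : (w.1.adicCompletion L)) (hϖ : Valued.v ϖ = WithZero.exp (-1 : ℤ))
  (A : GL (Fin 3) (w.1.adicCompletion L)) (hA : A ∈ glInt 3 (w.1.adicCompletion L))
  (hframe : (placeForm H' w.1) = (-(placeForm H' w.1).det) • formCongr (galAdicCompletionMap (L := L) (IsCMField.complexConj L) hw) A ((StdForm.antidiagonal 3).over (w.1.adicCompletion L)))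
  (e : ↥(UnitaryGroup.«local» L (IsCMField.complexConj L) 3 H' v) ≃ₜ* ↥(unitaryGroupOfForm (galAdicCompletionMap (L := L) (IsCMField.complexConj L) hw) (placeForm (Matrix.of fun i j : Fin 3 => if i.val + j.val + 1 = 3 then (1 : L) else 0) w.1)))
  (heA : ∀ g : ((cmDatum L 3 H').Local v), (((e g) : ↥(unitaryGroupOfForm (galAdicCompletionMap (L := L) (IsCMField.complexConj L) hw) (placeForm (Matrix.of fun i j : Fin 3 => if i.val + j.val + 1 = 3 then (1 : L) else 0) w.1))) : GL (Fin 3) (w.1.adicCompletion L)) =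
    A * ((localNonsplitEquiv (IsCMField.complexConj L) H' (IsCMField.complexConj_ne_one L) w hw g).val : GL (Fin 3) (w.1.adicCompletion L)) * A⁻¹)
  (hK : ∀ g : ((cmDatum L 3 H').Local v), g ∈ (cmLocalIntegralLevel L 3 H' v) ↔ (((e g) : ↥(unitaryGroupOfForm (galAdicCompletionMap (L := L) (IsCMField.complexConj L) hw) (placeForm (Matrix.of fun i j : Fin 3 => if i.val + j.val + 1 = 3 then (1 : L) else 0) w.1))) : GL (Fin 3) (w.1.adicCompletion L)) ∈ glInt 3 (w.1.adicCompletion L))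

include hw he hH'w hH'i h2 hϖ hA hframe in
set_option maxHeartbeats 1600000 in
-- budget only: statement-heavy CM-place tokens.
/-- **ON A `v`-DEEP CLASS THE COMPLEMENTARY RANK-ONE STRATUM IS THE `ε̄⁻¹`-TWISTED CLASS**: for `x = q⁻¹tq ∈ K′` with `rank(red x_w − 1) = 0`, `rank N(x) = 1`, the values `zᵀ(J̄N(x))z`
fill exactly one square class (★ p847189), so `¬(∃ z a ≠ 0, zᵀ(J̄N)z = a²) ⟺ ∃ z a ≠ 0, ε̄⁻¹·zᵀ(J̄N)z = a²` (`ε̄` a residual non-square). [cite: Rogawski1990, §4.9 p. 55; §3.9 p. 32] -/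
theorem ncard_fixedBy_interior_nonsq_eq_ncard_classMul_ramified (hH' : (H'.map (cmConjRingHom L)).transpose = H') (hσϖ : (galAdicCompletionMap (L := L) (IsCMField.complexConj L) hw) ϖ = -ϖ) (t : ((cmDatum L 3 H').Local v)) (htdeep : (∀ a b, Valued.v (((toPlace v w (HeckeCharacter.uniformizer ↥(maximalRealSubfield L) v : v.adicCompletion ↥(maximalRealSubfield L))) ^ 1)⁻¹ * ((((t).val : GL (Fin 3) (UnitaryGroup.LocalRing L v)).val.map (Pi.evalRingHom (fun w' : PlacesOver L v => w'.1.adicCompletion L) w)) a b - (1 : Matrix (Fin 3) (Fin 3) (w.1.adicCompletion L)) a b)) ≤ 1))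
    {ε : 𝓀[(w.1.adicCompletion L)]} (hε : ¬ IsSquare ε) :
    {q : (((cmDatum L 3 H').Local v) ⧸ cmLocalIntegralLevel L 3 H' v) | q ∈ MulAction.fixedBy (((cmDatum L 3 H').Local v) ⧸ cmLocalIntegralLevel L 3 H' v) t ∧ ((redMat (((((q.out⁻¹ * t * q.out)).val : GL (Fin 3) (UnitaryGroup.LocalRing L v)).val.map (Pi.evalRingHom (fun w' : PlacesOver L v => w'.1.adicCompletion L) w))) - 1).rank = 0 ∧ (redMat (ϖ⁻¹ • (((((q.out⁻¹ * t * q.out)).val : GL (Fin 3) (UnitaryGroup.LocalRing L v)).val.map (Pi.evalRingHom (fun w' : PlacesOver L v => w'.1.adicCompletion L) w)) - 1))).rank = 1 ∧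
        ¬ ∃ (z : Fin 3 → 𝓀[(w.1.adicCompletion L)]) (a : 𝓀[(w.1.adicCompletion L)]), a ≠ 0 ∧ z ⬝ᵥ ((redMat (placeForm H' w.1) * redMat (ϖ⁻¹ • (((((q.out⁻¹ * t * q.out)).val : GL (Fin 3) (UnitaryGroup.LocalRing L v)).val.map (Pi.evalRingHom (fun w' : PlacesOver L v => w'.1.adicCompletion L) w)) - 1))) *ᵥ z) = a ^ 2)}.ncard =
      {q : (((cmDatum L 3 H').Local v) ⧸ cmLocalIntegralLevel L 3 H' v) | q ∈ MulAction.fixedBy (((cmDatum L 3 H').Local v) ⧸ cmLocalIntegralLevel L 3 H' v) t ∧ ((redMat (((((q.out⁻¹ * t * q.out)).val : GL (Fin 3) (UnitaryGroup.LocalRing L v)).val.map (Pi.evalRingHom (fun w' : PlacesOver L v => w'.1.adicCompletion L) w))) - 1).rank = 0 ∧ (redMat (ϖ⁻¹ • (((((q.out⁻¹ * t * q.out)).val : GL (Fin 3) (UnitaryGroup.LocalRing L v)).val.map (Pi.evalRingHom (fun w' : PlacesOver L v => w'.1.adicCompletion L) w)) - 1))).rank = 1 ∧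
        ∃ (z : Fin 3 → 𝓀[(w.1.adicCompletion L)]) (a : 𝓀[(w.1.adicCompletion L)]), a ≠ 0 ∧ ε⁻¹ * (z ⬝ᵥ ((redMat (placeForm H' w.1) * redMat (ϖ⁻¹ • (((((q.out⁻¹ * t * q.out)).val : GL (Fin 3) (UnitaryGroup.LocalRing L v)).val.map (Pi.evalRingHom (fun w' : PlacesOver L v => w'.1.adicCompletion L) w)) - 1))) *ᵥ z)) = a ^ 2)}.ncard := by
  have hε0 : ε ≠ 0 := fun h0 => hε ⟨0, by rw [h0, mul_zero]⟩
  congr 1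
  ext q
  simp only [Set.mem_setOf_eq]
  refine and_congr_right fun hq => and_congr_right fun hr0 => and_congr_right fun hr1 => ?_
  have hx := inv_out_mul_mul_out_mem_of_mem_fixedBy (cmLocalIntegralLevel L 3 H' v) t hq
  have hx1 := ((guards_of_conj_mem_of_vDeep_ramified L H' w hw he hH'w hH'i h2 ϖ hϖ A hA hframe t htdeep q.out hx).2.1 hr0).1
  rw [not_exists_depthOne_value_eq_sq_iff_exists_eq_sq_mul_ramified L H' hH' w hw he hH'w hH'i h2 ϖ hϖ hσϖ hε hx hx1 hr1]
  refine exists_congr fun z => exists_congr fun a => and_congr_right fun _ => ?_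
  constructor
  · intro h; rw [h, mul_comm (a ^ 2) ε, ← mul_assoc, inv_mul_cancel₀ hε0, one_mul]
  · intro h
    calc z ⬝ᵥ ((redMat (placeForm H' w.1) * redMat (ϖ⁻¹ • (((((q.out⁻¹ * t * q.out)).val : GL (Fin 3) (UnitaryGroup.LocalRing L v)).val.map (Pi.evalRingHom (fun w' : PlacesOver L v => w'.1.adicCompletion L) w)) - 1))) *ᵥ z) = ε * (ε⁻¹ * (z ⬝ᵥ ((redMat (placeForm H' w.1) * redMat (ϖ⁻¹ • (((((q.out⁻¹ * t * q.out)).val : GL (Fin 3) (UnitaryGroup.LocalRing L v)).val.map (Pi.evalRingHom (fun w' : PlacesOver L v => w'.1.adicCompletion L) w)) - 1))) *ᵥ z))) := by rw [← mul_assoc, mul_inv_cancel₀ hε0, one_mul]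
      _ = a ^ 2 * ε := by rw [h, mul_comm]

include hw he hH'w hH'i h2 hϖ hA hframe heA hK in
set_option maxHeartbeats 1600000 in
-- budget only: statement-heavy CM-place tokens (two currencies).
/-- **A1′ part 2 (1□_{εc})**: for `t ∈ G′_v` `v`-deep, `c ∈ 𝒪_w` with `red c · red(−det H′_w) = 1` and a unit `ε ∈ 𝒪_w` with `red ε` a NON-SQUARE, the complementary rank-one stratum
of ★ p847154 is the lattice count of the class `ε·c`: `n_¬□(t) = #{M : M self-dual, (e t)M = M, LEV ϖ ∧ ¬ LEV ϖ² ∧ LEV₂ ϖ³ ∧ CLS (ε·c)}` (with ★ p847358's `…_interior_sq_…` the two (a2)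
rank-one classes are `1□_c` and `1□_{εc}`). [cite: Rogawski1990, §4.9 p. 55; §14.2 p. 233; §3.9 p. 32] [cite: Kottwitz1986, §3] -/
theorem ncard_fixedBy_interior_nonsq_eq_ncard_selfDual_fixed_classMul_ramified (hH' : (H'.map (cmConjRingHom L)).transpose = H') (hσϖ : (galAdicCompletionMap (L := L) (IsCMField.complexConj L) hw) ϖ = -ϖ) (t : ((cmDatum L 3 H').Local v)) (htdeep : (∀ a b, Valued.v (((toPlace v w (HeckeCharacter.uniformizer ↥(maximalRealSubfield L) v : v.adicCompletion ↥(maximalRealSubfield L))) ^ 1)⁻¹ * ((((t).val : GL (Fin 3) (UnitaryGroup.LocalRing L v)).val.map (Pi.evalRingHom (fun w' : PlacesOver L v => w'.1.adicCompletion L) w)) a b - (1 : Matrix (Fin 3) (Fin 3) (w.1.adicCompletion L)) a b)) ≤ 1))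
    {c : (w.1.adicCompletion L)} (hc : Valued.v c ≤ 1) (hcd : red c * red (-((placeForm H' w.1)).det) = 1) {ε : (w.1.adicCompletion L)} (hε1 : Valued.v ε ≤ 1) (hε : ¬ IsSquare (red ε)) :
    {q : (((cmDatum L 3 H').Local v) ⧸ cmLocalIntegralLevel L 3 H' v) | q ∈ MulAction.fixedBy (((cmDatum L 3 H').Local v) ⧸ cmLocalIntegralLevel L 3 H' v) t ∧ ((redMat (((((q.out⁻¹ * t * q.out)).val : GL (Fin 3) (UnitaryGroup.LocalRing L v)).val.map (Pi.evalRingHom (fun w' : PlacesOver L v => w'.1.adicCompletion L) w))) - 1).rank = 0 ∧ (redMat (ϖ⁻¹ • (((((q.out⁻¹ * t * q.out)).val : GL (Fin 3) (UnitaryGroup.LocalRing L v)).val.map (Pi.evalRingHom (fun w' : PlacesOver L v => w'.1.adicCompletion L) w)) - 1))).rank = 1 ∧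
        ¬ ∃ (z : Fin 3 → 𝓀[(w.1.adicCompletion L)]) (a : 𝓀[(w.1.adicCompletion L)]), a ≠ 0 ∧ z ⬝ᵥ ((redMat (placeForm H' w.1) * redMat (ϖ⁻¹ • (((((q.out⁻¹ * t * q.out)).val : GL (Fin 3) (UnitaryGroup.LocalRing L v)).val.map (Pi.evalRingHom (fun w' : PlacesOver L v => w'.1.adicCompletion L) w)) - 1))) *ᵥ z) = a ^ 2)}.ncard =
      {M : Submodule (Valued.integer (w.1.adicCompletion L)) (Fin 3 → (w.1.adicCompletion L)) | IsSelfDualLattice (galAdicCompletionMap (L := L) (IsCMField.complexConj L) hw) ϖ (placeForm (Matrix.of fun i j : Fin 3 => if i.val + j.val + 1 = 3 then (1 : L) else 0) w.1) M ∧ mapGL ((e t : ↥(unitaryGroupOfForm (galAdicCompletionMap (L := L) (IsCMField.complexConj L) hw) (placeForm (Matrix.of fun i j : Fin 3 => if i.val + j.val + 1 = 3 then (1 : L) else 0) w.1))) : GL (Fin 3) (w.1.adicCompletion L)) M = M ∧ (M.map ((Matrix.toLin' ((((e t : ↥(unitaryGroupOfForm (galAdicCompletionMap (L := L) (IsCMField.complexConj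 L) hw) (placeForm (Matrix.of fun i j : Fin 3 => if i.val + j.val + 1 = 3 then (1 : L) else 0) w.1))) : GL (Fin 3) (w.1.adicCompletion L)) : Matrix (Fin 3) (Fin 3) (w.1.adicCompletion L)) - 1)).restrictScalars (Valued.integer (w.1.adicCompletion L))) ≤ scaleLattice ϖ M ∧ ¬ M.map ((Matrix.toLin' ((((e t : ↥(unitaryGroupOfForm (galAdicCompletionMap (L := L) (IsCMField.complexConj L) hw) (placeForm (Matrix.of fun i j : Fin 3 => if i.val + j.val + 1 = 3 then (1 : L) else 0) w.1))) : GL (Fin 3) (w.1.adicCompletion L)) : Matrix (Fin 3) (Fin 3) (w.1.adicCompletion L)) - 1)).restrictScalars (Valued.integer (w.1.adicCompletion L))) ≤ scaleLattice (ϖ ^ 2) M ∧ M.map ((Matrix.toLin' (((((e t : ↥(unitaryGroupOfForm (galAdicCompletionMap (L := L) (IsCMField.complexConj L) hw) (placeForm (Matrix.of fun i j : Fin 3 => if i.val + j.val + 1 = 3 then (1 : L) else 0) w.1))) : GL (Fin 3) (w.1.adicCompletion L)) : Matrix (Fin 3) (Fin 3) (w.1.adicCompletion L)) - 1) ^ 2)).restrictScalars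 (Valued.integer (w.1.adicCompletion L))) ≤ scaleLattice (ϖ ^ 3) M ∧ ∃ y ∈ M, ∃ a : (w.1.adicCompletion L), Valued.v a = 1 ∧ Valued.v (ϖ⁻¹ * pairing (galAdicCompletionMap (L := L) (IsCMField.complexConj L) hw) (placeForm (Matrix.of fun i j : Fin 3 => if i.val + j.val + 1 = 3 then (1 : L) else 0) w.1) y (((((e t : ↥(unitaryGroupOfForm (galAdicCompletionMap (L := L) (IsCMField.complexConj L) hw) (placeForm (Matrix.of fun i j : Fin 3 => if i.val + j.val + 1 = 3 then (1 : L) else 0) w.1))) : GL (Fin 3) (w.1.adicCompletion L)) : Matrix (Fin 3) (Fin 3) (w.1.adicCompletion L)) - 1) *ᵥ y) - ε * c * a ^ 2) < 1)}.ncard := by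
  have hε0 : red ε ≠ 0 := fun h0 => hε ⟨0, by rw [h0, mul_zero]⟩
  have hεc : Valued.v (ε * c) ≤ 1 := by rw [map_mul]; exact mul_le_one' hε1 hc
  have hcd' : red (ε * c) * ((red ε)⁻¹ * red (-((placeForm H' w.1)).det)) = 1 := by
    rw [red_mul ((v_le_one_iff_mem_integer _).1 hε1) ((v_le_one_iff_mem_integer _).1 hc)]
    calc red ε * red c * ((red ε)⁻¹ * red (-((placeForm H' w.1)).det)) = (red ε * (red ε)⁻¹) * (red c * red (-((placeForm H' w.1)).det)) := by ring
      _ = 1 := by rw [mul_inv_cancel₀ hε0, hcd, one_mul]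
  rw [ncard_fixedBy_interior_nonsq_eq_ncard_classMul_ramified L H' w hw he hH'w hH'i h2 ϖ hϖ A hA hframe hH' hσϖ t htdeep hε,
    ncard_fixedBy_interior_classMul_eq_of_frame L H' w hw he hH'w hH'i ϖ hϖ A hA hframe e heA hK t (red ε)⁻¹]
  have hgen := ncard_fixedBy_quotient_rankOne_eq_ncard_selfDual_fixed (galAdicCompletionMap (L := L) (IsCMField.complexConj L) hw) hϖ (placeForm (Matrix.of fun i j : Fin 3 => if i.val + j.val + 1 = 3 then (1 : L) else 0) w.1)
      (isSelfDualLattice_stdLattice_placeForm_antidiagThree L w hw ϖ hϖ)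
      (fun _ hM => exists_unitary_mapGL_stdLattice_eq_placeForm_antidiagThree L w hw h2 ϖ hϖ hM) (e t)
      (vDeep_frame_of_vDeep L H' w hw he ϖ hϖ A hA e heA t htdeep)
      (fun a => valued_galAdicCompletionMap (L := L) (IsCMField.complexConj L) hw a) (valued_sigma_sub_self_lt_one L w hw he)
      (isIntMatrix_placeForm_antidiagThree L w) hεc
  rw [redMat_placeForm_antidiagThree L w] at hgen
  rw [← hgen]
  congr 1
  ext q
  simp only [Set.mem_setOf_eq]
  refine and_congr_right fun _ => and_congr_right fun _ => and_congr_right fun _ => ?_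
  exact exists_mul_eq_sq_iff_exists_eq_mul_sq_of_mul_eq_one hcd' _

end EpsilonClass


end Literature.NumberTheory.Automorphic.UnitaryGroup

end
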